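import Literature.Computability.Complexity.CNF
import Literature.Computability.MetaComplexity.Resolution
import HarnessLib

/-!
# Records of resolution lines: the assignment falsifying a clause

Trunk `CplxMeta`. Small shared vocabulary for arguments that walk or measure resolution
refutations line by line (Pudlák's Prover–Delayer plays, Bonacina 2017 Thm 8.5; the
medium-complexity-clause arguments of Beck–Impagliazzo / Bonacina 2017 Thm 8.1): a line of a
refutation carries a set-clause `C : Finset (Literal ℕ)`, and the *record* `α_C` is the partial
assignment falsifying it — defined on the variables occurring in `C` (`MemVar`), with value
`valC C v` (`true` iff the negative literal `(v, false)` is in `C`), meaningful when `C` is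
consistent, i.e. non-tautological (`IsNonTaut`). Used by `XorificationLiftProofs.lean`
(proof of Bonacina 2017 Thm 8.2) and by the width lower bound from expanding linear systems
(Bonacina 2017 Thm 8.1).

## References

* I. Bonacina, *Space in Weak Propositional Proof Systems*, Springer 2017, §2.1 (clauses,
  restrictions), §8.2 (records `α_C` in the proof of Thm 8.2, "let `α_C` denote the Boolean
  assignment setting `C` to false on domain `var(C)`", proof of Thm 8.5).
* J. Krajíček, *Proof Complexity*, CUP 2019, §5.1.
-/

namespace Literature.Computability.MetaComplexity

open Finset Complexity

/-- The clause of line `k` of `π` (`∅` out of range). [Krajíček 2019, §5.1] [folklore] -/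
def lineClause (π : List (ResLine ℕ)) (k : ℕ) : Finset (Literal ℕ) :=
  match π[k]? with
  | some L => L.clause
  | none => ∅

/-- In range, `lineClause` is the clause of the line. [folklore] -/
theorem lineClause_eq {π : List (ResLine ℕ)} {k : ℕ} (hk : k < π.length) :
    lineClause π k = (π[k]).clause := by
  simp [lineClause, List.getElem?_eq_getElem hk]

/-- The value given to the variable `v` by the assignment `α_C` falsifying the (consistent)
clause `C`: `true` iff the literal `¬v = (v, false)` is in `C`. [Bonacina 2017, §8.2
(`α_C`, proof of Thm 8.5)] [folklore] -/
def valC (C : Finset (Literal ℕ)) (v : ℕ) : Bool :=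
  decide ((v, false) ∈ C)

/-- `v` occurs in the clause `C` (`v ∈ dom α_C = var(C)`). [Bonacina 2017, §8.2] [folklore] -/
def MemVar (C : Finset (Literal ℕ)) (v : ℕ) : Prop :=
  (v, true) ∈ C ∨ (v, false) ∈ C

/-- A set-clause is non-tautological (consistent): it does not contain a variable with both
polarities, so that `α_C` is a well-defined partial assignment. [Bonacina 2017, §2.1]
[folklore] -/
def IsNonTaut (C : Finset (Literal ℕ)) : Prop :=
  ∀ v : ℕ, ¬ ((v, true) ∈ C ∧ (v, false) ∈ C)

/-- The value recorded for a variable of a consistent record: the literal `(y, ¬a) ∈ C` forces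
`α_C(y) = a`. [folklore] -/
theorem valC_of_mem {C : Finset (Literal ℕ)} (hC : IsNonTaut C) {y : ℕ} {a : Bool}
    (h : (y, !a) ∈ C) : valC C y = a := by
  cases a
  · have : (y, false) ∉ C := fun h' => hC y ⟨by simpa using h, h'⟩
    simp [valC, this]
  · simp only [Bool.not_true] at h
    simp [valC, h]

/-- Records growing by one literal keep the values of the other variables. [folklore] -/
theorem valC_eq_of_subset_insert {C C' : Finset (Literal ℕ)} (hC : IsNonTaut C) {l : Literal ℕ}
    (hsub : C' ⊆ insert l C) {y : ℕ} (hy : l.1 ≠ y) (hmem : MemVar C' y) :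
    valC C' y = valC C y := by
  by_cases h : (y, false) ∈ C'
  · have h' : (y, false) ∈ C := by
      have := hsub h
      rw [mem_insert] at this
      rcases this with h1 | h1
      · exact (hy (by rw [← h1])).elim
      · exact h1
    simp [valC, h, h']
  · have hyt : (y, true) ∈ C' := hmem.resolve_right h
    have hyt' : (y, true) ∈ C := by
      have := hsub hyt
      rw [mem_insert] at this
      rcases this with h1 | h1
      · exact (hy (by rw [← h1])).elim
      · exact h1
    have hyf : (y, false) ∉ C := fun h'' => hC y ⟨hyt', h''⟩
    simp [valC, h, hyf]

/-- Variables of a one-literal extension other than the new one were already present.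
[folklore] -/
theorem memVar_of_subset_insert {C C' : Finset (Literal ℕ)} {l : Literal ℕ} (hsub : C' ⊆ insert l C)
    {y : ℕ} (hy : l.1 ≠ y) (hmem : MemVar C' y) : MemVar C y := by
  rcases hmem with h | h
  · have := hsub h
    rw [mem_insert] at this
    rcases this with h1 | h1
    · exact (hy (by rw [← h1])).elim
    · exact Or.inl h1
  · have := hsub h
    rw [mem_insert] at this
    rcases this with h1 | h1
    · exact (hy (by rw [← h1])).elim
    · exact Or.inr h1

/-- Sub-clauses of consistent clauses are consistent. [folklore] -/
theorem IsNonTaut.mono {C C' : Finset (Literal ℕ)} (hC : IsNonTaut C) (h : C' ⊆ C) : IsNonTaut C' :=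
  fun v hv => hC v ⟨h hv.1, h hv.2⟩

/-- The empty clause is consistent. [folklore] -/
theorem isNonTaut_empty : IsNonTaut (∅ : Finset (Literal ℕ)) := fun v h => by simp at h

end Literature.Computability.MetaComplexity
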